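import Mathlib.Data.Real.Basic
import Mathlib.Data.Fintype.Basic
import Mathlib.Algebra.Order.Field.Basic
import Mathlib.Data.Finset.Max
import Mathlib.Tactic

/-!
# `Summit.QuantumFields.BalabanUV.Beta.ScaleBootstrap` — THE FINITE-MAX BOOTSTRAP: a family of nonnegative quantities each dominated by a
# weighted budget plus a SMALL multiple of the family's values on a neighbourhood of bounded weight growth is dominated by the budget
# outright (module 3a of road P3's reduction «rough-`Rm` gradient member ⇐ flat interior estimate (FG) + sup member + ONE (3.35)-shaped
# binder (SF)», claim «COVARIANT-FLAT-SPLIT»; generic, no lattice)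

HONEST FRAMING (page 1 of everything in this cell).  Discharging `FlowStep.BetaPertH` would make Bałaban's ultraviolet
stability UNCONDITIONAL — a constructive-QFT result; it is NOT the continuum limit and NOT the Clay problem.  This module
discharges nothing of `BetaPertH`; it is [folklore] elementary real analysis on a finite set, kernel-checked, by CO-OWNER #3 of binder row D4
(unit `b2b-balaban-beta-d4-p3`, road P3 «reduction road», gen 13).  HONEST DEPENDENCY: continuum YM on T⁴ ⇐ BetaPertH ∧ nine spine estimates
(0/9 proved); BetaPertH ⇐ (D1) ∧ (D4) ∧ CAP+tail; G-an2-4 gates asym, D1 and NE2/3/4.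

THE POINT.  In the covariant twin of the gradient member (O.2 item (i) for rough bond matrices) the flat interior estimate applied in the
(SF) gauge of a ball bounds the covariant difference at a bond `b` by a budget `A·ω(b)` (`ω(b) = n(b)·e^{−κ′d(b,k′)}·m`: local scale × decay
× source size) PLUS `δ·(max of the covariant differences over the bonds of the ball)`, with `δ ∝ σ₁` (the first-order coefficient of module 1's
split).  Since the weight `ω` grows at most by a factor `Γ` across a ball, the finite-max argument below turns this into the gradient member
`≤ A/(1 − δΓ)·ω(b)` as soon as `δΓ < 1` — print's «Mα₀ ≤ a₀ sufficiently small» at MODEL level.  Generic statement over a finite index type: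
* **`bootstrap_of_local`** — `X ≥ 0`, `ω > 0`, neighbourhoods `nb b` with `ω(b′) ≤ Γ·ω(b)` on `nb b`, `0 ≤ δ`, `δΓ < 1`, and the LOCAL
  inequality «`X b ≤ A·ω b + δ·Y` for every `Y ≥ 0` bounding `X` on `nb b`» ⟹ `X b ≤ A/(1 − δΓ)·ω b` for every `b`;
* `bootstrap_of_local_max` — the same with the local inequality stated at the actual maximum over a nonempty neighbourhood.
No lattice, no operator; the consumer instantiates `ι` = the bonds of the torus (or bonds × components).

LOCATORS (shape only, nothing printed asserted; ABSOLUTE RULE): [Balaban1985BackgroundPropagators] Thm 3.1 p. 397 («for M ≥ M₁ and … Mα₀ ≤ a₀»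
— the smallness under which the regularity estimates close).  Row D4: NO class change (critical-path width 0; D4 DISCHARGE NO DATE); NOT BetaPertH,
NOT continuum, NOT Clay, NOT summit progress.
-/

open scoped BigOperators
open Finset

namespace Summit.QuantumFields.BalabanUV.Beta.ScaleBootstrap

/-- **THE FINITE-MAX BOOTSTRAP.**  `ι` finite; `X ≥ 0`, `ω > 0` on `ι`; neighbourhoods `nb : ι → Finset ι` on which the weight grows at most
by `Γ ≥ 0` (`ω b′ ≤ Γ·ω b` for `b′ ∈ nb b`); constants `A`, `δ` with `δ·Γ < 1`; and the LOCAL inequality: for every `b` and every `Y ≥ 0` with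
`X b′ ≤ Y` for all `b′ ∈ nb b`, `X b ≤ A·ω b + δ·Y`.  Then `X b ≤ A/(1 − δ·Γ)·ω b` for every `b`.  Proof: at a maximiser `b*` of `X/ω` with
value `Q ≥ 0`, `Y := Q·Γ·ω b*` bounds `X` on `nb b*`, so `Q·ω b* ≤ A·ω b* + δ·Q·Γ·ω b*`, i.e. `Q(1 − δΓ) ≤ A` (no sign condition on
`A` or `δ` is needed). [folklore] -/
theorem bootstrap_of_local {ι : Type} [Fintype ι] (X ω : ι → ℝ) (hX : ∀ b, 0 ≤ X b) (hω : ∀ b, 0 < ω b)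
    (nb : ι → Finset ι) {Γ A δ : ℝ} (hΓ0 : 0 ≤ Γ) (hΓ : ∀ b, ∀ b' ∈ nb b, ω b' ≤ Γ * ω b)
    (hδΓ : δ * Γ < 1) (hloc : ∀ b (Y : ℝ), 0 ≤ Y → (∀ b' ∈ nb b, X b' ≤ Y) → X b ≤ A * ω b + δ * Y) (b : ι) :
    X b ≤ A / (1 - δ * Γ) * ω b := by
  classical
  -- a maximiser of `X/ω`
  have hne : (Finset.univ : Finset ι).Nonempty := ⟨b, Finset.mem_univ b⟩
  obtain ⟨bs, -, hbs⟩ := Finset.exists_max_image Finset.univ (fun b => X b / ω b) hne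
  set Q : ℝ := X bs / ω bs with hQ
  have hQ0 : 0 ≤ Q := div_nonneg (hX bs) (hω bs).le
  have hXle : ∀ b', X b' ≤ Q * ω b' := fun b' => by
    have h := hbs b' (Finset.mem_univ b')
    rwa [div_le_iff₀ (hω b')] at h
  -- the local inequality at the maximiser with `Y = Q·Γ·ω bs`
  have hmain : Q * ω bs ≤ A * ω bs + δ * (Q * Γ * ω bs) := by
    have hY0 : 0 ≤ Q * Γ * ω bs := by have := (hω bs).le; positivity
    have hY : ∀ b' ∈ nb bs, X b' ≤ Q * Γ * ω bs := by
      intro b' hb'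
      calc X b' ≤ Q * ω b' := hXle b'
        _ ≤ Q * (Γ * ω bs) := mul_le_mul_of_nonneg_left (hΓ bs b' hb') hQ0
        _ = Q * Γ * ω bs := by ring
    have h := hloc bs _ hY0 hY
    have e : X bs = Q * ω bs := by rw [hQ, div_mul_cancel₀ _ (hω bs).ne']
    linarith
  have hQle : Q * (1 - δ * Γ) ≤ A := by
    have hω0 := hω bs
    have : Q * (1 - δ * Γ) * ω bs ≤ A * ω bs := by nlinarith
    exact le_of_mul_le_mul_right this hω0
  have hQle' : Q ≤ A / (1 - δ * Γ) := by
    rw [le_div_iff₀ (by linarith)]; exact hQle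
  calc X b ≤ Q * ω b := hXle b
    _ ≤ A / (1 - δ * Γ) * ω b := mul_le_mul_of_nonneg_right hQle' (hω b).le

/-- **The bootstrap with the local inequality at the neighbourhood maximum**: if every `nb b` is nonempty and
`X b ≤ A·ω b + δ·max_{b′ ∈ nb b} X b′` (`δ ≥ 0`), the conclusion of `bootstrap_of_local` holds. [folklore] -/
theorem bootstrap_of_local_max {ι : Type} [Fintype ι] (X ω : ι → ℝ) (hX : ∀ b, 0 ≤ X b) (hω : ∀ b, 0 < ω b)
    (nb : ι → Finset ι) (hnb : ∀ b, (nb b).Nonempty) {Γ A δ : ℝ} (hΓ0 : 0 ≤ Γ) (hΓ : ∀ b, ∀ b' ∈ nb b, ω b' ≤ Γ * ω b)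
    (hδ : 0 ≤ δ) (hδΓ : δ * Γ < 1)
    (hloc : ∀ b, X b ≤ A * ω b + δ * (nb b).sup' (hnb b) X) (b : ι) :
    X b ≤ A / (1 - δ * Γ) * ω b := by
  refine bootstrap_of_local X ω hX hω nb hΓ0 hΓ hδΓ (fun b Y _ hY => ?_) b
  have hsup : (nb b).sup' (hnb b) X ≤ Y := Finset.sup'_le _ _ fun b' hb' => hY b' hb'
  exact (hloc b).trans (add_le_add le_rfl (mul_le_mul_of_nonneg_left hsup hδ))

/-- **Corollary in the shape the covariant assembly uses**: weights `ω b = n b · w b` with `n, w > 0` (local scale × decay factor), growth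
`n b′ ≤ Γ₁·n b` and `w b′ ≤ Γ₂·w b` on the neighbourhood (`Γ₁, Γ₂ ≥ 0`), local inequality with budget `A·n b·w b`; then
`X b ≤ A/(1 − δΓ₁Γ₂)·n b·w b` whenever `δΓ₁Γ₂ < 1`. [folklore] -/
theorem bootstrap_scale_decay {ι : Type} [Fintype ι] (X n w : ι → ℝ) (hX : ∀ b, 0 ≤ X b) (hn : ∀ b, 0 < n b) (hw : ∀ b, 0 < w b)
    (nb : ι → Finset ι) {Γ₁ Γ₂ A δ : ℝ} (hΓ₁ : 0 ≤ Γ₁) (hΓ₂ : 0 ≤ Γ₂) (hgrow : ∀ b, ∀ b' ∈ nb b, n b' ≤ Γ₁ * n b)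
    (hdec : ∀ b, ∀ b' ∈ nb b, w b' ≤ Γ₂ * w b) (hδΓ : δ * (Γ₁ * Γ₂) < 1)
    (hloc : ∀ b (Y : ℝ), 0 ≤ Y → (∀ b' ∈ nb b, X b' ≤ Y) → X b ≤ A * (n b * w b) + δ * Y) (b : ι) :
    X b ≤ A / (1 - δ * (Γ₁ * Γ₂)) * (n b * w b) := by
  refine bootstrap_of_local X (fun b => n b * w b) hX (fun b => mul_pos (hn b) (hw b)) nb (Γ := Γ₁ * Γ₂) (mul_nonneg hΓ₁ hΓ₂) ?_
    hδΓ hloc b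
  intro b b' hb'
  have h1 := hgrow b b' hb'
  have h2 := hdec b b' hb'
  calc n b' * w b' ≤ (Γ₁ * n b) * (Γ₂ * w b) := mul_le_mul h1 h2 (hw b').le (by have := (hn b).le; positivity)
    _ = Γ₁ * Γ₂ * (n b * w b) := by ring

end Summit.QuantumFields.BalabanUV.Beta.ScaleBootstrap
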